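import Mathlib.MeasureTheory.Integral.Prod
import Literature.Analysis.FluidPDE.PassiveScalarClassicalEnergy
import HarnessLib

/-!
# The fluctuation–dissipation identity for passive scalars (Johansson–Sorella 2024, Lemma 2.8)

Topic `Literature/Analysis/FluidPDE` (passive scalar cluster; theorems only). C. J. P. Johansson,
M. Sorella, *Anomalous dissipation via spontaneous stochasticity with a two-dimensional autonomous
velocity field*, arXiv:2409.03599 (Duke Math. J. 2025), Lemma 2.8 (p. 9), the
"fluctuation–dissipation equality" of Drivas–Eyink:

"Let `u ∈ C^∞([0,1] × T²)` be a divergence-free velocity field and `X^κ_{t,0}` be the backward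
stochastic flow and `θ_κ` be the solution to (ADV-DIFF) with a bounded initial datum `θ_in`, then
`∫_{T²} E[|θ_in(X^κ_{t,0}(x,·)) - E[θ_in(X^κ_{t,0}(x,·))]|²] dx = 2κ ∫₀ᵗ ∫_{T²} |∇θ_κ(x,s)|² dx ds`."
(FL-DISS)

Printed proof (p. 9): the energy equality
`∫|θ_κ(x,t)|² + 2κ∫₀ᵗ∫|∇θ_κ|² = ∫|θ_in|² = ∫ E[|θ_in(X^κ_{t,0}(x,·))|²] dx` (2.4), "where the last
equality follows from the fact that `x ↦ X^κ_{t,0}(x,ω)` is measure-preserving for all `ω`", and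
"by the Feynman–Kac formula `|θ_κ(x,t)|² = |E[θ_in(X^κ_{t,0}(x,·))]|²`. Plugging this into (2.4)
gives (FL-DISS)."

This file formalizes exactly this argument on `T^d` (any dimension), with the two genuinely
stochastic inputs isolated as hypotheses on an abstract random map `X : T^d → Ω → T^d` over a
probability space `(Ω, P)`:

* measure preservation of `x ↦ X x ω` for every `ω` (for the backward stochastic flow of a
  divergence-free drift with additive noise this is Liouville's theorem pathwise), and
* the representation `θ(t, x) = E[θ(a, X x ·)]` (the Feynman–Kac formula, source Thm. 2.7,
  Kunita 1984) — NOT proved here;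

the third input, the energy equality, is the tree's
`Torus.IsClassicalScalarTransportOn.scalarL2Sq_add_scalarDissipation_holds`. Results:

* `Torus.integral_sub_integral_sq_eq` — `E[(f - E f)²] = E[f²] - (E f)²` for bounded measurable `f`;
* `Torus.integral_integral_sq_comp_eq_of_measurePreserving` — `∫ E[g(X x ·)²] dx = ∫ g²`
  (Tonelli and measure preservation: the last equality of (2.4));
* `Torus.integral_variance_comp_eq_of_measurePreserving` — `∫ Var[g(X x ·)] dx = ‖g‖²_{L²} - ∫ (E[g(X x ·)])² dx`;
* `Torus.IsClassicalScalarTransportOn.fluctuation_dissipation_of_repr` — (FL-DISS) for a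
  classical solution on `[a, t]`, given measure preservation and the representation.

No stochastic calculus is used or introduced; no definition and no named fact (D-0026).

## References

* C. J. P. Johansson, M. Sorella, arXiv:2409.03599v2 (2024), Lemma 2.8 and (2.4), p. 9; Thm. 2.7
  (Feynman–Kac), Def. 2.6. [`JohanssonSorella2024`]
* T. D. Drivas, G. L. Eyink, *A Lagrangian fluctuation–dissipation relation for scalar
  turbulence. Part I*, J. Fluid Mech. 829 (2017) 153–189 (the original identity).
-/

open MeasureTheory Set Filter Function
open _root_.Topology
open scoped ENNReal NNReal

noncomputable section

namespace Literature.Analysis.FluidPDE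

namespace Torus

variable {Ω : Type*} [MeasurableSpace Ω] {P : Measure Ω}

/-- **Variance identity** `E[(f - E f)²] = E[f²] - (E f)²` for a bounded measurable `f` on a
probability space. [folklore] -/
theorem integral_sub_integral_sq_eq [IsProbabilityMeasure P] {f : Ω → ℝ} (hf : Measurable f)
    {C : ℝ} (hC : ∀ ω, |f ω| ≤ C) :
    ∫ ω, (f ω - ∫ ω', f ω' ∂P) ^ 2 ∂P = (∫ ω, f ω ^ 2 ∂P) - (∫ ω, f ω ∂P) ^ 2 := by
  set m : ℝ := ∫ ω', f ω' ∂P with hm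
  have hfi : Integrable f P :=
    (integrable_const C).mono' hf.aestronglyMeasurable (ae_of_all _ fun ω => by
      rw [Real.norm_eq_abs]; exact hC ω)
  have hf2i : Integrable (fun ω => f ω ^ 2) P :=
    (integrable_const (C ^ 2)).mono' (hf.pow_const 2).aestronglyMeasurable (ae_of_all _ fun ω => by
      rw [Real.norm_eq_abs, abs_pow]
      exact pow_le_pow_left₀ (abs_nonneg _) (hC ω) 2)
  have hexp : ∀ ω, (f ω - m) ^ 2 = f ω ^ 2 - 2 * m * f ω + m ^ 2 := fun ω => by ring
  simp_rw [hexp]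
  have h1 : Integrable (fun ω => f ω ^ 2 - 2 * m * f ω) P := hf2i.sub (hfi.const_mul _)
  have h2 : Integrable (fun ω => 2 * m * f ω) P := hfi.const_mul _
  rw [integral_add h1 (integrable_const _), integral_sub hf2i h2, integral_const_mul, integral_const]
  simp only [probReal_univ, one_smul]
  rw [← hm]
  ring

variable {d : Type*} [Fintype d]

/-- **The last equality of (2.4)**: if `x ↦ X x ω` preserves the Haar probability measure of `T^d`
for every `ω`, then `∫ E[g(X x ·)²] dx = ∫ g(x)² dx` for bounded measurable `g` (Tonelli, then
the change of variables `x ↦ X x ω` for each fixed `ω`). [cite: JohanssonSorella2024, Lemma 2.8 (proof, (2.4)), p. 9] -/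
theorem integral_integral_sq_comp_eq_of_measurePreserving [IsProbabilityMeasure P]
    {X : UnitAddTorus d → Ω → UnitAddTorus d} (hX : Measurable (uncurry X))
    (hmp : ∀ ω, MeasurePreserving (fun x => X x ω) volume volume)
    {g : UnitAddTorus d → ℝ} (hg : Measurable g) {C : ℝ} (hC : ∀ x, |g x| ≤ C) :
    ∫ x, ∫ ω, g (X x ω) ^ 2 ∂P = ∫ x, g x ^ 2 := by
  have hF : Measurable (uncurry fun (x : UnitAddTorus d) (ω : Ω) => g (X x ω) ^ 2) :=
    (hg.comp hX).pow_const 2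
  have hint : Integrable (uncurry fun (x : UnitAddTorus d) (ω : Ω) => g (X x ω) ^ 2)
      ((volume : Measure (UnitAddTorus d)).prod P) :=
    (integrable_const (C ^ 2)).mono' hF.aestronglyMeasurable (ae_of_all _ fun p => by
      rw [Real.norm_eq_abs]
      change |g (X p.1 p.2) ^ 2| ≤ C ^ 2
      rw [abs_pow]
      exact pow_le_pow_left₀ (abs_nonneg _) (hC _) 2)
  rw [integral_integral_swap hint]
  have hω : ∀ ω, ∫ x, g (X x ω) ^ 2 = ∫ x, g x ^ 2 := fun ω => by
    have hm : AEStronglyMeasurable (fun y => g y ^ 2)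
        (Measure.map (fun x => X x ω) (volume : Measure (UnitAddTorus d))) :=
      (hg.pow_const 2).aestronglyMeasurable
    rw [← integral_map (hmp ω).measurable.aemeasurable hm, (hmp ω).map_eq]
  simp_rw [hω]
  rw [integral_const]
  simp only [probReal_univ, one_smul]

/-- `|E f| ≤ C` for `|f| ≤ C` on a probability space. [folklore] -/
theorem abs_integral_le_of_abs_le [IsProbabilityMeasure P] {f : Ω → ℝ} {C : ℝ}
    (hC : ∀ ω, |f ω| ≤ C) : |∫ ω, f ω ∂P| ≤ C := by
  have h := norm_integral_le_of_norm_le_const (μ := P) (f := f) (C := C)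
    (ae_of_all _ fun ω => by rw [Real.norm_eq_abs]; exact hC ω)
  simpa [Real.norm_eq_abs, probReal_univ] using h

/-- **Space-integrated variance under a measure-preserving random map**:
`∫ E[(g(X x ·) - E[g(X x ·)])²] dx = ∫ g² - ∫ (E[g(X x ·)])² dx` for bounded measurable `g`
(the variance identity pointwise in `x`, then `integral_integral_sq_comp_eq_of_measurePreserving`).
[cite: JohanssonSorella2024, Lemma 2.8 (proof), p. 9] -/
theorem integral_variance_comp_eq_of_measurePreserving [IsProbabilityMeasure P]
    {X : UnitAddTorus d → Ω → UnitAddTorus d} (hX : Measurable (uncurry X))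
    (hmp : ∀ ω, MeasurePreserving (fun x => X x ω) volume volume)
    {g : UnitAddTorus d → ℝ} (hg : Measurable g) {C : ℝ} (hC : ∀ x, |g x| ≤ C) :
    ∫ x, ∫ ω, (g (X x ω) - ∫ ω', g (X x ω') ∂P) ^ 2 ∂P =
      (∫ x, g x ^ 2) - ∫ x, (∫ ω, g (X x ω) ∂P) ^ 2 := by
  have hXx : ∀ x : UnitAddTorus d, Measurable fun ω => X x ω := fun x =>
    hX.comp measurable_prodMk_left
  -- pointwise variance identity
  have hpt : ∀ x, ∫ ω, (g (X x ω) - ∫ ω', g (X x ω') ∂P) ^ 2 ∂P =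
      (∫ ω, g (X x ω) ^ 2 ∂P) - (∫ ω, g (X x ω) ∂P) ^ 2 := fun x =>
    integral_sub_integral_sq_eq (hg.comp (hXx x)) fun ω => hC _
  simp_rw [hpt]
  -- integrability in `x` of the two terms
  have hF : Measurable (uncurry fun (x : UnitAddTorus d) (ω : Ω) => g (X x ω) ^ 2) :=
    (hg.comp hX).pow_const 2
  have hint : Integrable (uncurry fun (x : UnitAddTorus d) (ω : Ω) => g (X x ω) ^ 2)
      ((volume : Measure (UnitAddTorus d)).prod P) :=
    (integrable_const (C ^ 2)).mono' hF.aestronglyMeasurable (ae_of_all _ fun p => by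
      rw [Real.norm_eq_abs]
      change |g (X p.1 p.2) ^ 2| ≤ C ^ 2
      rw [abs_pow]
      exact pow_le_pow_left₀ (abs_nonneg _) (hC _) 2)
  have hAi : Integrable (fun x : UnitAddTorus d => ∫ ω, g (X x ω) ^ 2 ∂P) volume :=
    hint.integral_prod_left
  have hBm : Measurable fun x : UnitAddTorus d => (∫ ω, g (X x ω) ∂P) ^ 2 := by
    have hG : StronglyMeasurable (uncurry fun (x : UnitAddTorus d) (ω : Ω) => g (X x ω)) :=
      (hg.comp hX).stronglyMeasurable
    exact hG.integral_prod_right.measurable.pow_const 2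
  have hBi : Integrable (fun x : UnitAddTorus d => (∫ ω, g (X x ω) ∂P) ^ 2) volume :=
    (integrable_const (C ^ 2)).mono' hBm.aestronglyMeasurable (ae_of_all _ fun x => by
      rw [Real.norm_eq_abs, abs_pow]
      exact pow_le_pow_left₀ (abs_nonneg _) (abs_integral_le_of_abs_le fun ω => hC _) 2)
  rw [integral_sub hAi hBi, integral_integral_sq_comp_eq_of_measurePreserving hX hmp hg hC]

variable [DecidableEq d]

/-- **Johansson–Sorella 2024, Lemma 2.8 (fluctuation–dissipation), given the Feynman–Kac
representation.** Let `θ` be a classical solution of `∂ₜθ + u·∇θ = κΔθ` on `S ⊇ [a, t]`, and let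
`X : T^d → Ω → T^d` be a jointly measurable random map over a probability space such that
`x ↦ X x ω` preserves the volume of `T^d` for every `ω` (for the backward stochastic flow
`X^κ_{t,a}` of the divergence-free drift `u` with noise `√(2κ) dW`, Def. 2.6, this is Liouville's
theorem pathwise) and the representation `θ(t, x) = E[θ(a, X x ·)]` holds (Feynman–Kac, source
Thm. 2.7). Then
`∫_{T^d} E[|θ(a, X x ·) - E[θ(a, X x ·)]|²] dx = 2κ ∫ₐᵗ ∫_{T^d} |∇θ(s, x)|² dx ds`,
i.e. (FL-DISS) with `θ_in = θ(a)`. Proof as printed: the space-integrated variance equals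
`‖θ(a)‖²_{L²} - ‖θ(t)‖²_{L²}` (measure preservation and the representation), which is
`2κ ∫ₐᵗ ‖∇θ‖²` by the energy equality (2.4)
(`scalarL2Sq_add_scalarDissipation_holds`). [cite: JohanssonSorella2024, Lemma 2.8, p. 9] -/
theorem IsClassicalScalarTransportOn.fluctuation_dissipation_of_repr [IsProbabilityMeasure P]
    {S : Set ℝ} {κ : ℝ} {u : ℝ → UnitAddTorus d → EuclideanSpace ℝ d}
    {θ : ℝ → UnitAddTorus d → ℝ} (hθ : IsClassicalScalarTransportOn S κ u θ) {a t : ℝ}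
    (hat : a ≤ t) (hI : Icc a t ⊆ S) {X : UnitAddTorus d → Ω → UnitAddTorus d}
    (hX : Measurable (uncurry X)) (hmp : ∀ ω, MeasurePreserving (fun x => X x ω) volume volume)
    (hrepr : ∀ x, θ t x = ∫ ω, θ a (X x ω) ∂P) :
    ∫ x, ∫ ω, (θ a (X x ω) - ∫ ω', θ a (X x ω') ∂P) ^ 2 ∂P = 2 * scalarDissipation κ θ a t := by
  have ha : a ∈ S := hI ⟨le_rfl, hat⟩
  have hθa : FunctionSpaces.Torus.IsSmooth (θ a) := hθ.smooth_scalar.isSmooth_slice ha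
  obtain ⟨C, hC⟩ : ∃ C : ℝ, ∀ x, |θ a x| ≤ C := by
    obtain ⟨C, hC⟩ := isCompact_univ.exists_bound_of_continuousOn hθa.continuous.continuousOn
    exact ⟨C, fun x => by simpa [Real.norm_eq_abs] using hC x (mem_univ x)⟩
  rw [integral_variance_comp_eq_of_measurePreserving hX hmp hθa.continuous.measurable hC]
  have henergy := IsClassicalScalarTransportOn.scalarL2Sq_add_scalarDissipation_holds hθ hat hI
  simp only [scalarL2Sq] at henergy
  have hrepr' : ∫ x, (∫ ω, θ a (X x ω) ∂P) ^ 2 = ∫ x, θ t x ^ 2 := by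
    refine integral_congr_ae (ae_of_all _ fun x => ?_)
    simp only [hrepr x]
  rw [hrepr']
  linarith

end Torus

end Literature.Analysis.FluidPDE

end
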